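import Summits.QuantumAdvantage.QuantumAdvantage.Theorems.SteerDialRotList

/-!
# SteerDial (11): SteerDialInvBridge — relative loss transport and the repaired cover bridge (rotation-invariant algebra factored out)

Part 11 of the prover-side twin of the lineage decomp-qadv-lens-5 steering programme, generation 9, workshop node
«TagDial» rev 3 §3/§5 (sha256 6a47a487…).  Two results, sorry-free:
* `card_loss_spliceRL_le_rel` — the adaptive-steering loss transport of part 8 counted INSIDE an arbitrary body event
  `p`: `#({p} ∩ Loss(splice)) ≤ T·#({ψ = 1} ∩ Loss P) + #({p} ∩ Bad)`;
* `steerDial_algCover3_of_inv` — SUPPORTS item 30909: (the algebraic-event cover restricted to ROTATION-INVARIANT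
  tests, workshop `InvCover3`) ∧ (the strategy-free dichotomy «modulo a rotation-invariant dense polylog-degree event,
  certified rotation lists cover every dense polylog-degree event», workshop `InvModCover3`) ⟹ `Theses.SpreadDial.AlgCover3`.
  This replaces the rev-1 bridge from the refuted hypothesis `AdaptiveNoSat3` (body-only rotation-invariant tests are
  inert to pad/rotation certificates; critic row 60).
No `def … : Prop`, no `instance`, no `notation`.
-/

set_option linter.style.longLine false
set_option linter.dupNamespace false

namespace Summit.QuantumAdvantage.QuantumAdvantage.Theorems.SteerDial

open Finset
open Literature.Computability.QuantumComplexity Literature.Computability.MetaComplexity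
open Literature.Computability.QuantumComplexity.RingHLF
open Summit.QuantumAdvantage.AdviceFreeQNC0
open Summit.QuantumAdvantage.QuantumAdvantage.Theses

/-! ## §1  Relative loss transport -/

section Steer
variable {n m T : ℕ}

/-- **Relative loss transport** (rev 3): the same count INSIDE an arbitrary body event `p` —
`#({p} ∩ Loss(splice)) ≤ T·#({ψ = 1} ∩ Loss P) + #({p} ∩ Bad)`. -/
theorem card_loss_spliceRL_le_rel (hn : 3 ≤ n) (hm : 1 ≤ m) (ψ : Smolensky.CubeFn (ZMod 3) (n + m)) (r : Fin T → ℕ)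
    {u α β : Fin T → Fin m → Bool} {a b : Fin T → Bool} (cert : ∀ t, wordCert (u t) (α t) (β t) (a t) (b t) = true)
    (P : Fin (n + m) → Smolensky.CubeFn (ZMod 3) (n + m)) (p : (Fin n → Bool) → Prop) [DecidablePred p] :
    (univ.filter fun y : Fin n → Bool => p y ∧ ¬ RingHLF.Rel y (fun i => decide (spliceRL ψ r u α β a b P i y = 1))).card ≤
      T * (univ.filter fun x : Fin (n + m) → Bool => ψ x = 1 ∧ ¬ RingHLF.Rel x (fun b' => decide (P b' x = 1))).card +
        (univ.filter fun y : Fin n → Bool => p y ∧ ∀ t : Fin T, ψ (pad (u t) (rot (r t) y)) ≠ 1).card := by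
  classical
  set L := univ.filter fun y : Fin n → Bool => p y ∧ ¬ RingHLF.Rel y (fun i => decide (spliceRL ψ r u α β a b P i y = 1))
  set EL := univ.filter fun x : Fin (n + m) → Bool => ψ x = 1 ∧ ¬ RingHLF.Rel x (fun b' => decide (P b' x = 1))
  set Bad := univ.filter fun y : Fin n → Bool => p y ∧ ∀ t : Fin T, ψ (pad (u t) (rot (r t) y)) ≠ 1
  set A : Fin T → Finset (Fin n → Bool) := fun t =>
    univ.filter fun y => firstGood ψ r u t y = true ∧ ¬ RingHLF.Rel (steerPt r u t y) (bits P (steerPt r u t y))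
  have hsub : L ⊆ Bad ∪ (univ : Finset (Fin T)).biUnion A := by
    intro y hy
    rw [Finset.mem_filter] at hy
    rw [Finset.mem_union]
    by_cases hg : ∃ t, good ψ r u t y = true
    · obtain ⟨t₀, ht₀⟩ := exists_firstGood hg
      refine Or.inr (Finset.mem_biUnion.2 ⟨t₀, mem_univ _, Finset.mem_filter.2 ⟨mem_univ _, ht₀, ?_⟩⟩)
      exact loss_transportRL hn hm cert P ht₀ hy.2.2
    · refine Or.inl (Finset.mem_filter.2 ⟨mem_univ _, hy.2.1, fun t hψt => hg ⟨t, ?_⟩⟩)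
      unfold good steerPt
      exact decide_eq_true hψt
  have hA : ∀ t, (A t).card ≤ EL.card := fun t => by
    refine Finset.card_le_card_of_injOn (steerPt r u t) (fun y hy => ?_) (fun y _ y' _ hyy => steerPt_injective r u t hyy)
    rw [Finset.mem_coe, Finset.mem_filter] at hy ⊢
    exact ⟨mem_univ _, good_of_firstGood hy.2.1, hy.2.2⟩
  calc L.card ≤ (Bad ∪ (univ : Finset (Fin T)).biUnion A).card := Finset.card_le_card hsub
    _ ≤ Bad.card + ((univ : Finset (Fin T)).biUnion A).card := Finset.card_union_le _ _
    _ ≤ Bad.card + ∑ t, (A t).card := Nat.add_le_add_left Finset.card_biUnion_le _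
    _ ≤ Bad.card + ∑ _t : Fin T, EL.card := Nat.add_le_add_left (Finset.sum_le_sum fun t _ => hA t) _
    _ = T * EL.card + Bad.card := by rw [Finset.sum_const, Finset.card_univ, Fintype.card_fin, smul_eq_mul]; ring

end Steer

/-! ## §2  The repaired bridge -/

section Node

/-- **SUPPORTS item 30909 `SpreadDial.AlgCover3` — THE REPAIRED BRIDGE.**  (workshop `InvCover3`) ∧ (workshop
`InvModCover3`) ⟹ `AlgCover3` (both hypotheses inlined): steer adaptively (§3), count the spliced
strategy's losses INSIDE the invariant event `{φ = 1}` (`card_loss_spliceRL_le_rel`), lower-bound them by `InvCover3`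
applied to the splice on the `n`-ring, and absorb `{φ = 1} ∩ Bad` by `InvModCover3`; then the gen-9 bookkeeping. -/
theorem steerDial_algCover3_of_inv
    (hI : SpreadDial.PolyLoss3 → ∃ η : ℝ, 0 < η ∧ ∃ k : ℕ, ∀ c : ℕ, ∃ n₀ : ℕ, ∀ n ≥ n₀,
      ∀ P : Fin n → Smolensky.CubeFn (ZMod 3) n, (∀ i, P i ∈ Smolensky.lowDeg (ZMod 3) n ((Nat.log 2 n) ^ c)) →
      ∀ φ : Smolensky.CubeFn (ZMod 3) n, φ ∈ Smolensky.lowDeg (ZMod 3) n ((Nat.log 2 n) ^ c) →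
      (∀ y : Fin n → Bool, φ (rot 1 y) = φ y) →
      (1 - η) * (2 : ℝ) ^ n ≤ ((univ.filter fun y : Fin n → Bool => φ y = 1).card : ℝ) →
      1 / (n : ℝ) ^ k * (2 : ℝ) ^ n ≤
      ((univ.filter fun y : Fin n → Bool => φ y = 1 ∧ ¬ RingHLF.Rel y (fun i => decide (P i y = 1))).card : ℝ))
    (hM : ∀ ηI : ℝ, 0 < ηI → ∃ η : ℝ, 0 < η ∧ ∀ k' : ℕ, ∃ m : ℕ, 1 ≤ m ∧ ∃ c₁ : ℕ, ∀ c : ℕ, ∃ c' : ℕ, ∃ n₀ : ℕ, ∀ n ≥ n₀,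
      ∀ ψ : Smolensky.CubeFn (ZMod 3) (n + m), ψ ∈ Smolensky.lowDeg (ZMod 3) (n + m) ((Nat.log 2 (n + m)) ^ c) →
      (1 - η) * (2 : ℝ) ^ (n + m) ≤ ((univ.filter fun x : Fin (n + m) → Bool => ψ x = 1).card : ℝ) →
      ∃ T : ℕ, T ≤ (Nat.log 2 n) ^ c₁ ∧ ∃ r : Fin T → ℕ, ∃ u α β : Fin T → Fin m → Bool, ∃ a b : Fin T → Bool,
      (∀ t, wordCert (u t) (α t) (β t) (a t) (b t) = true) ∧
      ∃ φ : Smolensky.CubeFn (ZMod 3) n, φ ∈ Smolensky.lowDeg (ZMod 3) n ((Nat.log 2 n) ^ c') ∧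
      (∀ y : Fin n → Bool, φ (rot 1 y) = φ y) ∧
      (1 - ηI) * (2 : ℝ) ^ n ≤ ((univ.filter fun y : Fin n → Bool => φ y = 1).card : ℝ) ∧
      ((univ.filter fun y : Fin n → Bool =>
      φ y = 1 ∧ ∀ t : Fin T, ψ (pad (u t) (rot (r t) y)) ≠ 1).card : ℝ) ≤
      1 / (n : ℝ) ^ k' * (2 : ℝ) ^ n) :
    SpreadDial.AlgCover3 := by
  intro hP
  obtain ⟨ηI, hηI, k₁, hk₁⟩ := hI hP
  clear hI
  obtain ⟨η, hη, hMη⟩ := hM ηI hηI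
  clear hM
  obtain ⟨m, hm, c₁, hc₁⟩ := hMη (k₁ + 1)
  clear hMη
  refine ⟨η, hη, k₁ + c₁ + m + 2, fun c => ?_⟩
  obtain ⟨c', n₂, hn₂⟩ := hc₁ c
  set cI := 2 * c + c₁ + 2 + c' with hcI
  obtain ⟨n₁, hn₁⟩ := hk₁ cI
  refine ⟨max (max n₁ n₂) (2 ^ (2 * m + 4)) + m, fun N hN P hPdeg ψ hψ hdense => ?_⟩
  obtain ⟨n, rfl⟩ : ∃ n, N = n + m := ⟨N - m, by omega⟩
  have hn1 : n₁ ≤ n := by omega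
  have hn2 : n₂ ≤ n := by omega
  have hnM : 2 ^ (2 * m + 4) ≤ n := by omega
  have hn3 : 3 ≤ n := by
    have : 2 ^ 4 ≤ 2 ^ (2 * m + 4) := Nat.pow_le_pow_right (by norm_num) (by omega)
    omega
  have hn2' : 2 ≤ n := by omega
  obtain ⟨T, hT, r, u, α, β, a, b, hcert, φ, hφdeg, hφinv, hφdense, hBad⟩ := hn₂ n hn2 ψ hψ hdense
  -- the spliced strategy on the n-ring and its degree
  have hL1 : 0 < Nat.log 2 n := Nat.log_pos (by norm_num) hn2'
  have hQdeg : ∀ i, spliceRL ψ r u α β a b P i ∈ Smolensky.lowDeg (ZMod 3) n ((Nat.log 2 n) ^ cI) := fun i =>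
    Smolensky.lowDeg_mono ((degree_budgetRL m c c₁ n hnM T hT).trans (Nat.pow_le_pow_right hL1 (by omega)))
      (spliceRL_mem_lowDeg hψ r u α β a b hPdeg i)
  have hφdeg' : φ ∈ Smolensky.lowDeg (ZMod 3) n ((Nat.log 2 n) ^ cI) :=
    Smolensky.lowDeg_mono (Nat.pow_le_pow_right hL1 (by omega)) hφdeg
  -- InvCover3 on the splice, inside {φ = 1}
  have hcov := hn₁ n hn1 (spliceRL ψ r u α β a b P) hQdeg φ hφdeg' hφinv hφdense
  have htr := card_loss_spliceRL_le_rel hn3 hm ψ r hcert P (fun y : Fin n → Bool => φ y = 1)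
  have htr' : ((univ.filter fun y : Fin n → Bool =>
        φ y = 1 ∧ ¬ RingHLF.Rel y (fun i => decide (spliceRL ψ r u α β a b P i y = 1))).card : ℝ) ≤
      (T : ℝ) * ((univ.filter fun x : Fin (n + m) → Bool =>
          ψ x = 1 ∧ ¬ RingHLF.Rel x (fun b' => decide (P b' x = 1))).card : ℝ) +
        ((univ.filter fun y : Fin n → Bool => φ y = 1 ∧ ∀ t : Fin T, ψ (pad (u t) (rot (r t) y)) ≠ 1).card : ℝ) := by
    exact_mod_cast htr
  have hsteer := hcov.trans htr'
  set EL := ((univ.filter fun x : Fin (n + m) → Bool =>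
      ψ x = 1 ∧ ¬ RingHLF.Rel x (fun b' => decide (P b' x = 1))).card : ℝ) with hEL
  clear hcov htr htr' hφinv hφdense hφdeg hφdeg' hQdeg hcert hψ hPdeg hdense hn₂ hc₁ hk₁ hn₁ hP
  have hELnn : 0 ≤ EL := by positivity
  have hnpos : (0 : ℝ) < n := by exact_mod_cast (by omega : 0 < n)
  have hn2r : (2 : ℝ) ≤ n := by exact_mod_cast hn2'
  -- T ≤ (log₂ n)^c₁ ≤ n^c₁
  have hTle : (T : ℝ) ≤ (n : ℝ) ^ c₁ := by
    have : T ≤ n ^ c₁ := hT.trans (Nat.pow_le_pow_left (Nat.log_lt_of_lt_pow (by omega) Nat.lt_two_pow_self).le c₁)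
    exact_mod_cast this
  have h1 : 1 / (n : ℝ) ^ k₁ * (2 : ℝ) ^ n - 1 / (n : ℝ) ^ (k₁ + 1) * (2 : ℝ) ^ n ≤ (n : ℝ) ^ c₁ * EL := by
    have := mul_le_mul_of_nonneg_right hTle hELnn
    linarith
  have h2 : 1 / (2 * (n : ℝ) ^ k₁) * (2 : ℝ) ^ n ≤ 1 / (n : ℝ) ^ k₁ * (2 : ℝ) ^ n - 1 / (n : ℝ) ^ (k₁ + 1) * (2 : ℝ) ^ n := by
    have hk : (0 : ℝ) < (n : ℝ) ^ k₁ := by positivity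
    have e1 : 1 / (n : ℝ) ^ (k₁ + 1) = 1 / (n : ℝ) ^ k₁ * (1 / n) := by
      rw [pow_succ]; field_simp
    rw [e1]
    have e2 : 1 / (n : ℝ) ≤ 1 / 2 := by
      rw [div_le_div_iff₀ hnpos (by norm_num : (0:ℝ) < 2)]; linarith
    have e3 : (0 : ℝ) ≤ 1 / (n : ℝ) ^ k₁ * (2 : ℝ) ^ n := by positivity
    have e4 : 1 / (2 * (n : ℝ) ^ k₁) = 1 / (n : ℝ) ^ k₁ * (1 / 2) := by field_simp
    rw [e4]
    nlinarith
  have h3 : 1 / (2 * (n : ℝ) ^ k₁) * (2 : ℝ) ^ n ≤ (n : ℝ) ^ c₁ * EL := h2.trans h1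
  have hc₁pos : (0 : ℝ) < (n : ℝ) ^ c₁ := by positivity
  have h4 : 1 / (2 * (n : ℝ) ^ (k₁ + c₁)) * (2 : ℝ) ^ n ≤ EL := by
    rw [pow_add]
    have e : 1 / (2 * ((n : ℝ) ^ k₁ * (n : ℝ) ^ c₁)) * (2 : ℝ) ^ n = (1 / (2 * (n : ℝ) ^ k₁) * (2 : ℝ) ^ n) / (n : ℝ) ^ c₁ := by
      field_simp
    rw [e, div_le_iff₀ hc₁pos]
    linarith
  have hnat : 2 ^ (n + m) * (2 * n ^ (k₁ + c₁)) ≤ 2 ^ n * (n + m) ^ (k₁ + c₁ + m + 2) := by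
    have e1 : (n + m) ^ (k₁ + c₁ + m + 2) = (n + m) ^ (k₁ + c₁) * (n + m) ^ (m + 2) := by
      ring
    have e2 : n ^ (k₁ + c₁) ≤ (n + m) ^ (k₁ + c₁) := Nat.pow_le_pow_left (by omega) _
    have e3 : 2 ^ (m + 2) ≤ (n + m) ^ (m + 2) := Nat.pow_le_pow_left (by omega) _
    calc 2 ^ (n + m) * (2 * n ^ (k₁ + c₁)) = 2 ^ n * (n ^ (k₁ + c₁) * 2 ^ (m + 1)) := by ring
      _ ≤ 2 ^ n * ((n + m) ^ (k₁ + c₁) * (n + m) ^ (m + 2)) := by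
          refine Nat.mul_le_mul_left _ (Nat.mul_le_mul e2 (le_trans ?_ e3))
          exact Nat.pow_le_pow_right (by norm_num) (by omega)
      _ = 2 ^ n * (n + m) ^ (k₁ + c₁ + m + 2) := by rw [e1]
  have hreal : (2 : ℝ) ^ (n + m) * (2 * (n : ℝ) ^ (k₁ + c₁)) ≤ (2 : ℝ) ^ n * (((n + m : ℕ) : ℝ)) ^ (k₁ + c₁ + m + 2) := by
    exact_mod_cast hnat
  have hNpos : (0 : ℝ) < (((n + m : ℕ) : ℝ)) ^ (k₁ + c₁ + m + 2) := by positivity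
  have hkpos : (0 : ℝ) < 2 * (n : ℝ) ^ (k₁ + c₁) := by positivity
  have h5 : 1 / (((n + m : ℕ) : ℝ)) ^ (k₁ + c₁ + m + 2) * (2 : ℝ) ^ (n + m) ≤ 1 / (2 * (n : ℝ) ^ (k₁ + c₁)) * (2 : ℝ) ^ n := by
    rw [div_mul_eq_mul_div, div_mul_eq_mul_div, one_mul, one_mul, div_le_div_iff₀ hNpos hkpos]
    linarith
  exact h5.trans h4

end Node

end Summit.QuantumAdvantage.QuantumAdvantage.Theorems.SteerDial
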